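import Literature.Probability.RandomPlanarGeometry.YangBaxterSAWExcursionJordan
import HarnessLib

/-!
# Reversal flips the winding: the excursion polygon of the reversed companion

[cite: Glazman2015WeightedSAW, Lemma 3.1 (proof, pp. 6–7)] [cite: GlazmanManolescu2019, Lemma 2.1 (proof: [Gl], Lemma 3.1)]
[cite: AhlforsCA1979, Ch. 4 §2.1 (index of a point with respect to a closed curve; n(−γ, a) = −n(γ, a))]

In Glazman–Manolescu's grouping of the walks through a rhombus `r` (`YangBaxterSAWGeneralDomain`), a walk `ω` of class `B2a` — it
enters `r`, crosses it by its first arc in `r` from the side `z₀` to the side `z₁`, makes an excursion outside `r` and returns to the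
side `z₂ = ω.1` — has a REVERSED COMPANION `ω.rev hr` (same prefix, first arc `z₀ → z₂`, the excursion traversed backwards, return at
`z₁`). The swept angle `ΩG.AJ hr h b` of the closed EXCURSION POLYGON `J(ω)` (`ΩG.pJ`: the inner point `c₁` of the exit side, the drawing
points of the excursion arcs, the inner point `c₂` of the return side, closed by the chord `c₂ → c₁`) about a base point `b` is the
quantity through which the lane's winding bookkeeping runs (Part T of `YangBaxterSAWGeneralDomain`, the Jordan-curve dichotomy of
`YangBaxterSAWExcursionJordan`, `ΩG.Unwound` of `YangBaxterSAWUnwoundPlaquette`, the hole-root laws). The definition of `ΩG.Unwound`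
carries the companion's winding angle as a separate conjunct «rather than through a reversal lemma». This file proves the reversal lemma:

* `sweep_reverse_eq_neg` — the swept angle of a closed polygon traversed backwards is minus the swept angle, for a base point off its
  closed edges (`angAt_swap`: the secant quotient lies in the slit plane);
* `ΩG.arcAt_rev`, `ΩG.fc_sIn_sOut_rev`, `ΩG.ptIn_ptOut_rev` — the excursion arcs of `rev ω` are those of `ω` swapped and in reverse
  order, so their drawing points are exchanged; ★ `ΩG.pJ_rev` — `pJ (rev ω) k = pJ ω (2 Mv − 1 − k)`: the excursion polygon of the companion
  IS the reversed polygon (same starting corner `c₂`);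
* ★★ `ΩG.AJ_rev_eq_neg` — `AJ (rev ω) b = − AJ ω b` for every `b` off the closed edges of `J(ω)`; `ΩG.AJ_rev_midPt_eq_neg` (midpoints of
  uncrossed mid-edges), ★★ `ΩG.AJ_rev_root_eq_neg` (the midpoint of the root, any rooted rhombus of any domain), ★
  `ΩG.unwound_iff_AJ_root_eq_zero` (`Unwound` ⟺ the walk's own root winding vanishes), `ΩG.AJ_rev_root_eq_zero_iff`, and ★
  `ΩG.wind_pJlist_rev_eq_neg` (the integer winding number of the polygonal loop flips).

All statements are for an arbitrary domain `D`, root `a` and rooted rhombus `r` (`RootedFace D a r`); no angle `θ` enters.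
-/

noncomputable section

open Real

namespace Literature.Probability.RandomPlanarGeometry.SAW

namespace YangBaxter

open Literature.Topology.PlaneTopology

/-- The angle subtended at `b` by a step is the argument of the quotient of the two secants. [folklore] [cite: AhlforsCA1979, Ch. 4 §2.1 (the argument along a curve)] -/
theorem angAt_eq_arg_div {b P₀ P₁ : ℂ} (h0 : P₀ ≠ b) (h1 : P₁ ≠ b) :
    angAt b P₀ P₁ = Complex.arg ((P₁ - b) / (P₀ - b)) := by
  rw [angAt, ← Complex.arg_div_coe_angle (sub_ne_zero.2 h1) (sub_ne_zero.2 h0), Real.Angle.toReal_coe_eq_self_iff]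
  exact ⟨Complex.neg_pi_lt_arg _, Complex.arg_le_pi _⟩

/-- **Antisymmetry of the subtended angle**: seen from a point `b` off the closed segment `[P₀, P₁]`, the step `P₁ → P₀` subtends minus the
angle of `P₀ → P₁` (the quotient of the secants lies in the slit plane, so its argument is not `π`). [folklore]
[cite: AhlforsCA1979, Ch. 4 §2.1 (index of a point with respect to a closed curve: reversing the curve reverses the index)] -/
theorem angAt_swap {b P₀ P₁ : ℂ} (hb : b ∉ segment ℝ P₀ P₁) : angAt b P₁ P₀ = -angAt b P₀ P₁ := by
  have h0 : P₀ ≠ b := fun e => hb (e ▸ left_mem_segment _ _ _)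
  have h1 : P₁ ≠ b := fun e => hb (e ▸ right_mem_segment _ _ _)
  rw [angAt_eq_arg_div h1 h0, angAt_eq_arg_div h0 h1, ← inv_div, Complex.arg_inv]
  have hsl : (P₁ - b) / (P₀ - b) ∈ Complex.slitPlane := by
    have := crossRatioFn_mem_slitPlane (ℓ := P₁) (r := P₀) (z := b) (by rwa [segment_symm])
    unfold crossRatioFn at this
    rwa [← neg_sub b P₁, ← neg_sub b P₀, neg_div_neg_eq]
  rw [if_neg (Complex.slitPlane_arg_ne_pi hsl)]

/-- **The swept angle of the reversed closed polygon is minus the swept angle**, for a base point off its closed edges: if `p N = p 0`,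
`q k = p (N − 1 − k)` for `k + 1 ≤ N` and `q N = q 0`, then `sweep b q N = − sweep b p N`. [folklore]
[cite: AhlforsCA1979, Ch. 4 §2.1 (n(−γ, a) = −n(γ, a))] -/
theorem sweep_reverse_eq_neg (b : ℂ) (p q : ℕ → ℂ) (N : ℕ) (hN : p N = p 0)
    (hq : ∀ k, k + 1 ≤ N → q k = p (N - 1 - k)) (hqN : q N = q 0)
    (hb : ∀ k < N, b ∉ segment ℝ (p k) (p (k + 1))) : sweep b q N = -sweep b p N := by
  rcases Nat.eq_zero_or_pos N with rfl | hpos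
  · simp [sweep]
  obtain ⟨M, rfl⟩ : ∃ M, N = M + 1 := ⟨N - 1, by omega⟩
  rw [sweep, sweep, Finset.sum_range_succ, Finset.sum_range_succ, hqN, hq 0 (by omega), hN]
  -- reindex the first M terms of `q`
  have e1 : ∑ k ∈ Finset.range M, angAt b (q k) (q (k + 1)) =
      ∑ k ∈ Finset.range M, -angAt b (p k) (p (k + 1)) := by
    rw [← Finset.sum_range_reflect]
    refine Finset.sum_congr rfl fun k hk => ?_
    rw [Finset.mem_range] at hk
    rw [hq (M - 1 - k) (by omega), hq (M - 1 - k + 1) (by omega),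
      show M + 1 - 1 - (M - 1 - k) = k + 1 by omega, show M + 1 - 1 - (M - 1 - k + 1) = k by omega]
    exact angAt_swap (hb k (by omega))
  rw [e1, Finset.sum_neg_distrib, show M + 1 - 1 - 0 = M by omega, hq M le_rfl, show M + 1 - 1 - M = 0 by omega]
  have e2 : angAt b (p 0) (p M) = -angAt b (p M) (p 0) := by
    have := hb M (by omega); rw [hN] at this; exact angAt_swap this
  rw [e2]; ring

open MidEdge
open Literature.Barriers.CriticalPhenomena.PlaquetteWalk

namespace YBWalk

variable {D : Set Face} {a z : MidEdge} {γ : YBWalk D a z}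

/-- The face and the sides of an arc given as a pair of sides of a rhombus. [cite: GlazmanManolescu2019, §1 (Fig. 2: an arc joins two sides of a rhombus)] -/
theorem fc_sIn_sOut_of_arcAt {i : ℕ} {f : Face} {s t : Side} (hst : s ≠ t) (h : γ.arcAt i = (f.side s, f.side t)) :
    γ.fc i = f ∧ γ.sIn i = s ∧ γ.sOut i = t := by
  have hf : arcFace (f.side s, f.side t) = some f := arcFace_side_side f s t hst
  have hfc : γ.fc i = f := by rw [fc, h, faceOf_eq hf]
  obtain ⟨h1, h2, -⟩ := side_sideIn hf
  refine ⟨hfc, ?_, ?_⟩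
  · rw [sIn, h]; exact f.side_injective h1
  · rw [sOut, h]; exact f.side_injective h2

/-- The `i`-th arc joins the `i`-th and `(i+1)`-st mid-edges of the walk. [cite: GlazmanManolescu2019, §1 (Fig. 2)] -/
theorem arcAt_eq_nth {i : ℕ} (hi : i < γ.arcs.length) : γ.arcAt i = (γ.nth i, γ.nth (i + 1)) := by
  rw [arcAt_eq hi, nth_eq_getElem, nth_eq_getElem]

/-- The `i`-th arc as the pair (entry side, exit side) of its rhombus. [cite: GlazmanManolescu2019, §1 (Fig. 2)] -/
theorem arcAt_eq_side {i : ℕ} (hi : i < γ.arcs.length) :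
    γ.arcAt i = ((γ.fc i).side (γ.sIn i), (γ.fc i).side (γ.sOut i)) := by
  obtain ⟨h1, h2, -⟩ := side_sIn hi
  rw [arcAt_eq hi, h1, h2]

/-- The `i`-th mid-edge is the entry side of the `i`-th arc. [cite: GlazmanManolescu2019, §1 (Fig. 2)] -/
theorem nth_eq_side_sIn {i : ℕ} (hi : i < γ.arcs.length) : γ.nth i = (γ.fc i).side (γ.sIn i) := by
  have h := arcAt_eq_side hi
  rw [arcAt_eq_nth hi, Prod.mk.injEq] at h
  exact h.1

/-- The `(i+1)`-st mid-edge is the exit side of the `i`-th arc. [cite: GlazmanManolescu2019, §1 (Fig. 2)] -/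
theorem nth_succ_eq_side_sOut {i : ℕ} (hi : i < γ.arcs.length) : γ.nth (i + 1) = (γ.fc i).side (γ.sOut i) := by
  have h := arcAt_eq_side hi
  rw [arcAt_eq_nth hi, Prod.mk.injEq] at h
  exact h.2

/-- An arc enters and leaves its rhombus through different sides. [cite: GlazmanManolescu2019, §1 (Fig. 2)] -/
theorem sIn_ne_sOut {i : ℕ} (hi : i < γ.arcs.length) : γ.sIn i ≠ γ.sOut i := (side_sIn hi).2.2

end YBWalk

namespace ΩG

open YBWalk

open private rev_snd_nth rev_snd_length rev_firstHit pJ_lt pJ_c₂ Qp_mid fh_add_Mv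
  from Literature.Probability.RandomPlanarGeometry.YangBaxterSAWGeneralDomain

variable {D : Set Face} {a : MidEdge} {r : Face} {ω : ΩG D a r}

/-- The reversed companion has the same number of excursion arcs. [cite: Glazman2015WeightedSAW, Lemma 3.1 (proof, pp. 6–7: «traverse the excursion backwards»)]
[cite: GlazmanManolescu2019, Lemma 2.1 (proof)] -/
theorem Mv_rev (hr : RootedFace D a r) (h : ω.IsB2a) : (ω.rev hr).Mv = ω.Mv := by
  unfold ΩG.Mv; rw [rev_snd_length ω hr h, rev_firstHit ω hr h]

/-- **The excursion arcs of the reversed companion are the arcs of the excursion, swapped and in reverse order**: the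
`(fh + j)`-th arc of `rev ω` (`1 ≤ j ≤ Mv − 1`) joins the exit side to the entry side of the `(n − j)`-th arc of `ω`.
[cite: Glazman2015WeightedSAW, Lemma 3.1 (proof, pp. 6–7)] [cite: GlazmanManolescu2019, Lemma 2.1 (proof)] -/
theorem arcAt_rev (hr : RootedFace D a r) (h : ω.IsB2a) {j : ℕ} (hj : 1 ≤ j) (hj' : j + 1 ≤ ω.Mv) :
    (ω.rev hr).2.arcAt (ω.2.firstHitG + j) =
      ((ω.2.fc (ω.2.arcs.length - j)).side (ω.2.sOut (ω.2.arcs.length - j)),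
        (ω.2.fc (ω.2.arcs.length - j)).side (ω.2.sIn (ω.2.arcs.length - j))) := by
  have hM := fh_add_Mv (ω := ω) h
  have hn := rev_snd_length ω hr h
  have hi : ω.2.arcs.length - j < ω.2.arcs.length := by omega
  rw [arcAt_eq_nth (by rw [hn]; omega), rev_snd_nth ω hr h (by omega), if_neg (by omega),
    rev_snd_nth ω hr h (by omega), if_neg (by omega),
    show ω.2.arcs.length + ω.2.firstHitG + 1 - (ω.2.firstHitG + j) = ω.2.arcs.length - j + 1 by omega,
    show ω.2.arcs.length + ω.2.firstHitG + 1 - (ω.2.firstHitG + j + 1) = ω.2.arcs.length - j by omega,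
    nth_succ_eq_side_sOut hi, nth_eq_side_sIn hi]

/-- Faces and sides of the reversed excursion: same rhombus, entry and exit sides exchanged. [cite: Glazman2015WeightedSAW, Lemma 3.1 (proof, pp. 6–7)] -/
theorem fc_sIn_sOut_rev (hr : RootedFace D a r) (h : ω.IsB2a) {j : ℕ} (hj : 1 ≤ j) (hj' : j + 1 ≤ ω.Mv) :
    (ω.rev hr).2.fc (ω.2.firstHitG + j) = ω.2.fc (ω.2.arcs.length - j) ∧
      (ω.rev hr).2.sIn (ω.2.firstHitG + j) = ω.2.sOut (ω.2.arcs.length - j) ∧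
      (ω.rev hr).2.sOut (ω.2.firstHitG + j) = ω.2.sIn (ω.2.arcs.length - j) := by
  have hM := fh_add_Mv (ω := ω) h
  exact fc_sIn_sOut_of_arcAt (sIn_ne_sOut (by omega)).symm (arcAt_rev hr h hj hj')

/-- The drawing points of the reversed excursion: the entry point of the `(fh + j)`-th arc of `rev ω` is the exit point of the `(n − j)`-th arc
of `ω` and vice versa. [cite: Glazman2015WeightedSAW, Lemma 3.1 (proof, pp. 6–7)] -/
theorem ptIn_ptOut_rev (hr : RootedFace D a r) (h : ω.IsB2a) {j : ℕ} (hj : 1 ≤ j) (hj' : j + 1 ≤ ω.Mv) :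
    (ω.rev hr).2.ptIn (ω.2.firstHitG + j) = ω.2.ptOut (ω.2.arcs.length - j) ∧
      (ω.rev hr).2.ptOut (ω.2.firstHitG + j) = ω.2.ptIn (ω.2.arcs.length - j) := by
  obtain ⟨h1, h2, h3⟩ := fc_sIn_sOut_rev hr h hj hj'
  simp only [ptIn, ptOut, h1, h2, h3, and_self]

/-- ★ **THE EXCURSION POLYGON OF THE REVERSED COMPANION IS THE REVERSED POLYGON**: `pJ (rev ω) k = pJ ω (2 Mv − 1 − k)` for
`k + 1 ≤ 2 Mv` — it starts at the inner point of the return side (`c₂`, the old chord end), runs the excursion backwards through the exit and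
entry points of its arcs, ends at the inner point of the exit side (`c₁`) and closes by the chord, reversed.
[cite: Glazman2015WeightedSAW, Lemma 3.1 (proof, pp. 6–7: the reversed excursion)] [cite: GlazmanManolescu2019, Lemma 2.1 (proof)] -/
theorem pJ_rev (hr : RootedFace D a r) (h : ω.IsB2a) {k : ℕ} (hk : k + 1 ≤ 2 * ω.Mv) :
    (ω.rev hr).pJ hr (ω.rev_isB2a hr h) k = ω.pJ hr h (2 * ω.Mv - 1 - k) := by
  have hM := fh_add_Mv (ω := ω) h
  have hM3 := ω.three_le_Mv hr h
  have hMr := Mv_rev hr h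
  have hfr := rev_firstHit ω hr h
  have hnr := rev_snd_length ω hr h
  set h' := ω.rev_isB2a hr h
  rcases Nat.eq_zero_or_pos k with rfl | hk0
  · -- k = 0 : c₂ on both sides
    rw [Nat.sub_zero, pJ_lt h' (by omega), ΩG.qQ, ΩG.Qp_two, pJ_c₂ h]
    congr 3
    -- (rev).z1 = ω.1
    exact ω.rev_exitSide hr h
  by_cases hkt : k = 2 * ω.Mv - 1
  · -- the chord end: c₁ on both sides
    subst hkt
    have e := pJ_c₂ (hr := hr) h'
    rw [hMr] at e
    rw [e, Nat.sub_self, pJ_lt h (by omega), ΩG.qQ, ΩG.Qp_two]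
    congr 3
    exact ω.rev_fst hr h
  -- 1 ≤ k ≤ 2Mv − 2 : walk vertices
  rw [pJ_lt h' (by omega), pJ_lt h (by omega), ΩG.qQ, ΩG.qQ, Qp_mid h' (by omega) (by omega),
    Qp_mid h (by omega) (by omega), hfr]
  congr 1
  obtain ⟨j, hj | hj⟩ : ∃ j, k = 2 * j - 1 ∨ k = 2 * j := ⟨(k + 1) / 2, by omega⟩
  · -- k odd: entry point of the reversed arc fh + j = exit point of arc n − j
    have hj1 : 1 ≤ j := by omega
    have hj2 : j + 1 ≤ ω.Mv := by omega
    rw [show 2 * ω.2.firstHitG + (k + 2) = 2 * (ω.2.firstHitG + j) + 1 by omega,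
      vtx_odd (by rw [hnr]; omega), (ptIn_ptOut_rev hr h hj1 hj2).1,
      show 2 * ω.2.firstHitG + (2 * ω.Mv - 1 - k + 2) = 2 * (ω.2.arcs.length - j) + 2 by omega, vtx_even (by omega)]
  · have hj1 : 1 ≤ j := by omega
    have hj2 : j + 1 ≤ ω.Mv := by omega
    rw [show 2 * ω.2.firstHitG + (k + 2) = 2 * (ω.2.firstHitG + j) + 2 by omega,
      vtx_even (by rw [hnr]; omega), (ptIn_ptOut_rev hr h hj1 hj2).2,
      show 2 * ω.2.firstHitG + (2 * ω.Mv - 1 - k + 2) = 2 * (ω.2.arcs.length - j) + 1 by omega, vtx_odd (by omega)]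

/-- ★★ **REVERSAL FLIPS THE WINDING ANGLE.** For every class-`B2a` walk `ω` at a rooted rhombus of ANY domain and every base point `b` off
the closed edges of its excursion polygon `J`, the winding angle of the excursion polygon of the reversed companion `rev ω` about `b` is
MINUS that of `ω`: `AJ (rev ω) b = − AJ ω b`. (The tree's `ΩG.Unwound` carried the companion's winding as a separate hypothesis «rather
than through a reversal lemma» — this is that lemma; `unwound_iff_AJ_root_eq_zero` below drops the second conjunct.)
[cite: Glazman2015WeightedSAW, Lemma 3.1 (proof, pp. 6–7: the companion traverses the excursion backwards, its winding is opposite)]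
[cite: GlazmanManolescu2019, Lemma 2.1 (proof)] [cite: AhlforsCA1979, Ch. 4 §2.1 (n(−γ, a) = −n(γ, a))] -/
theorem AJ_rev_eq_neg (hr : RootedFace D a r) (h : ω.IsB2a) {b : ℂ}
    (hb : ∀ k < 2 * ω.Mv, b ∉ segment ℝ (ω.pJ hr h k) (ω.pJ hr h (k + 1))) :
    (ω.rev hr).AJ hr (ω.rev_isB2a hr h) b = -ω.AJ hr h b := by
  rw [ΩG.AJ, ΩG.AJ, Mv_rev hr h]
  exact sweep_reverse_eq_neg b _ _ _ (pJ_closed h) (fun k hk => pJ_rev hr h hk)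
    (by rw [← Mv_rev hr h]; exact pJ_closed (ω.rev_isB2a hr h)) hb

open private midPt_not_mem_edges_at from Literature.Probability.RandomPlanarGeometry.YangBaxterSAWExcursionJordan

/-- **Reversal flips the winding angle at the midpoint of every mid-edge the excursion does not cross.**
[cite: Glazman2015WeightedSAW, Lemma 3.1 (proof, pp. 6–7)] [cite: GlazmanManolescu2019, Lemma 2.1 (proof)] -/
theorem AJ_rev_midPt_eq_neg (hr : RootedFace D a r) (h : ω.IsB2a) {b : Face} {τ : Side}
    (hb : ∀ j < ω.Mv, (ω.jFace h j).side (ω.jOut hr h j) ≠ b.side τ) :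
    (ω.rev hr).AJ hr (ω.rev_isB2a hr h) (toC (midPt (b.side τ))) = -ω.AJ hr h (toC (midPt (b.side τ))) :=
  AJ_rev_eq_neg hr h (midPt_not_mem_edges_at h hb)

/-- Every mid-edge is a side of a rhombus (`vert k j = (k, j).side W`, `slant k j = (k, j).side S`). [cite: GlazmanManolescu2019, Fig. 4] -/
theorem _root_.Literature.Probability.RandomPlanarGeometry.SAW.YangBaxter.MidEdge.exists_eq_side (e : MidEdge) :
    ∃ (b : Face) (τ : Side), b.side τ = e := by
  cases e with
  | vert k j => exact ⟨(k, j), .W, rfl⟩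
  | slant k j => exact ⟨(k, j), .S, rfl⟩

/-- ★★ **REVERSAL FLIPS THE WINDING ANGLE AT THE ROOT**: `AJ (rev ω) (midPt a) = − AJ ω (midPt a)` for every class-`B2a` walk at a rooted
rhombus of any domain (the root mid-edge is never crossed by the excursion, `exit_ne_root`). With Part T (`AJ_midPt_side_eq`): the
excursion of the companion winds `∓2π` about the root exactly when that of `ω` winds `±2π`.
[cite: Glazman2015WeightedSAW, Lemma 3.1 (proof, pp. 6–7)] [cite: GlazmanManolescu2019, Lemma 2.1 (statement, «in the form given in [Gl]»)] -/
theorem AJ_rev_root_eq_neg (hr : RootedFace D a r) (h : ω.IsB2a) :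
    (ω.rev hr).AJ hr (ω.rev_isB2a hr h) (toC (midPt a)) = -ω.AJ hr h (toC (midPt a)) := by
  obtain ⟨b, τ, hbτ⟩ := MidEdge.exists_eq_side a
  have hb : ∀ j < ω.Mv, (ω.jFace h j).side (ω.jOut hr h j) ≠ b.side τ :=
    fun j hj e => exit_ne_root (hr := hr) h hj (e.trans hbτ)
  have key := AJ_rev_midPt_eq_neg hr h hb
  rwa [hbτ] at key

/-- ★ **`Unwound` needs one winding only**: a walk is unwound at the root iff the winding angle of ITS excursion polygon at the midpoint of
the root vanishes for every class-`B2a` structure — the companion's follows by reversal.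
[cite: GlazmanManolescu2019, Lemma 2.1 (statement, «in the form given in [Gl]»)] [cite: Glazman2015WeightedSAW, Lemma 3.1 (proof)] -/
theorem unwound_iff_AJ_root_eq_zero (hr : RootedFace D a r) :
    ω.Unwound hr ↔ ∀ h : ω.IsB2a, ω.AJ hr h (toC (midPt a)) = 0 := by
  refine ⟨fun hU h => (hU h).1, fun hA h => ⟨hA h, ?_⟩⟩
  rw [AJ_rev_root_eq_neg hr h, hA h, neg_zero]

/-- The companion's excursion is unwound about the root iff the walk's is. [cite: GlazmanManolescu2019, Lemma 2.1] [cite: Glazman2015WeightedSAW, Lemma 3.1 (proof)] -/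
theorem AJ_rev_root_eq_zero_iff (hr : RootedFace D a r) (h : ω.IsB2a) :
    (ω.rev hr).AJ hr (ω.rev_isB2a hr h) (toC (midPt a)) = 0 ↔ ω.AJ hr h (toC (midPt a)) = 0 := by
  rw [AJ_rev_root_eq_neg hr h, neg_eq_zero]

/-- ★ **REVERSAL FLIPS THE WINDING NUMBER** of the excursion polygon (as a polygonal loop of the plane-topology library) about every point off
its closed edges: `wind(J(rev ω); b) = − wind(J(ω); b)` — through `AJ = 2π · wind` (`ΩG.AJ_eq_two_pi_mul_wind`) on both sides.
[cite: AhlforsCA1979, Ch. 4 §2.1 (n(−γ, a) = −n(γ, a))] [cite: GlazmanManolescu2019, Lemma 2.1 (proof)] -/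
theorem wind_pJlist_rev_eq_neg (hr : RootedFace D a r) (h : ω.IsB2a) {b : ℂ}
    (hb : ∀ k < 2 * ω.Mv, b ∉ segment ℝ (ω.pJ hr h k) (ω.pJ hr h (k + 1))) :
    wind (fun t ↦ polygonLoop ((ω.rev hr).pJlist hr (ω.rev_isB2a hr h)) t - b) =
      -wind (fun t ↦ polygonLoop (ω.pJlist hr h) t - b) := by
  have hb' : ∀ k < 2 * (ω.rev hr).Mv, b ∉ segment ℝ ((ω.rev hr).pJ hr (ω.rev_isB2a hr h) k)
      ((ω.rev hr).pJ hr (ω.rev_isB2a hr h) (k + 1)) := by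
    intro k hk
    rw [Mv_rev hr h] at hk
    rw [pJ_rev hr h (by omega)]
    rcases Nat.lt_or_ge (k + 1) (2 * ω.Mv) with hk1 | hk1
    · rw [pJ_rev hr h (by omega), show 2 * ω.Mv - 1 - k = 2 * ω.Mv - 1 - (k + 1) + 1 by omega, segment_symm]
      exact hb _ (by omega)
    · -- the closing edge: k + 1 = 2 Mv
      have e : (ω.rev hr).pJ hr (ω.rev_isB2a hr h) (k + 1) = ω.pJ hr h (2 * ω.Mv - 1) := by
        rw [show k + 1 = 2 * (ω.rev hr).Mv by rw [Mv_rev hr h]; omega, pJ_closed (ω.rev_isB2a hr h),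
          pJ_rev hr h (by omega), Nat.sub_zero]
      rw [e, show 2 * ω.Mv - 1 - k = 0 by omega, ← pJ_closed h, show 2 * ω.Mv = 2 * ω.Mv - 1 + 1 by omega,
        segment_symm]
      exact hb _ (by omega)
  have e1 := AJ_eq_two_pi_mul_wind (hr := hr) h hb
  have e2 := AJ_eq_two_pi_mul_wind (hr := hr) (ω.rev_isB2a hr h) hb'
  have e3 := AJ_rev_eq_neg hr h hb
  have hπ : (2 : ℝ) * π ≠ 0 := by positivity
  have : (2 * π) * ((wind (fun t ↦ polygonLoop ((ω.rev hr).pJlist hr (ω.rev_isB2a hr h)) t - b) : ℝ) +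
      wind (fun t ↦ polygonLoop (ω.pJlist hr h) t - b)) = 0 := by
    rw [mul_add, ← e1, ← e2, e3]; ring
  have := (mul_eq_zero.1 this).resolve_left hπ
  exact_mod_cast (by linarith : (wind (fun t ↦ polygonLoop ((ω.rev hr).pJlist hr (ω.rev_isB2a hr h)) t - b) : ℝ) =
    -wind (fun t ↦ polygonLoop (ω.pJlist hr h) t - b))

end ΩG

end YangBaxter

end Literature.Probability.RandomPlanarGeometry.SAW
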